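import Literature.Probability.RandomPlanarGeometry.SLETraceMeasurable
import Literature.Probability.RandomPlanarGeometry.SLETraceCriterionProofs
import Literature.Probability.RandomPlanarGeometry.ChordalBoundary
import Literature.Probability.RandomPlanarGeometry.ConformalMapCaratheodoryProofs
import HarnessLib

/-!
# Existence of the chordal SLE_κ random curve is equivalent to the SLE trace theorems

Trunk T-STOCH. The named fact `Literature.Probability.RandomPlanarGeometry.exists_isSLECurve`
(`Literature/Probability/RandomPlanarGeometry/SLE.lean`: for every `κ > 0` and every Dobrushin
domain `(D; a, b)` there is an a.e.-measurable random curve `Γ` with `IsSLECurve κ D Γ`, i.e.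
almost surely the Loewner chain of `√κ B` is generated by its trace `γ` and `Γ` is the class of
the time-compactified image `s ↦ Φ(γ(s/(1-s)))`, `1 ↦ b`, of the trace under the boundary
extension `Φ` of a chordal uniformizing map `φ : ℍₒ → D`) was reduced in this library to the
three SLE trace theorems (`Literature.Probability.RandomPlanarGeometry.exists_isSLECurve_of_trace_theorems`,
`SLETraceMeasurable.lean`):

* `hasSLETrace_eight` — SLE₈ is generated by a curve (Lawler–Schramm–Werner, Ann. Probab. 32
  (2004), Thm. 4.7);
* `hasSLETrace_of_ne_eight` — SLE_κ, `κ ≠ 8`, is generated by a curve (Rohde–Schramm, Ann. Math.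
  161 (2005), Thm. 5.1; reduced further to their Thm. 3.6 in `SLETraceCriterionProofs.lean`);
* `tendsto_norm_sleTrace_atTop` — transience of the trace, `κ > 0` (Rohde–Schramm Thm. 7.1).

This file proves the **converse** of that reduction, so that

* `Literature.Probability.RandomPlanarGeometry.exists_isSLECurve_iff` :
    `exists_isSLECurve ↔ hasSLETrace_eight ∧ hasSLETrace_of_ne_eight ∧ tendsto_norm_sleTrace_atTop`.

In words: the existence statement for chordal SLE_κ in Dobrushin domains, as vendored, carries
exactly the content of Rohde–Schramm's Theorems 5.1 and 7.1 (with the `κ = 8` case of [LSW04]);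
there is no cheaper route to it, and conversely nothing beyond these theorems is needed (the
Riemann mapping theorem, Carathéodory's theorem, the Loewner theory and the measurability of the
trace being theorems of the tree).

The two implications from `IsSLECurve κ D Γ`:

* `IsSLECurve.hasSLETrace`: the almost sure clause of `IsSLECurve` contains
  `Loewner.IsGeneratedByCurve (sleDriving κ ω) (sleTrace κ ω)`, whence `HasSLETrace κ`; applied
  to the unit disc (`DobrushinDomain.unitDisc`) this gives `HasSLETrace κ` for every `κ > 0` from
  `exists_isSLECurve`, hence `hasSLETrace_eight` and — with the proved `κ = 0` case
  `hasSLETrace_zero` (explicit flow, `SLETraceCriterionProofs.lean`) — `hasSLETrace_of_ne_eight`.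
* `IsSLECurve.ae_tendsto_norm_sleTrace_atTop` (transience): almost surely the compactified image
  `c` is a *continuous* curve on `[0, 1]` with `c 1 = b`, so `Φ(γ(t)) → b` as `t → ∞`
  (`IsCompactifiedImage.tendsto_atTop`, through the inverse `t ↦ t/(1+t)` of the ray
  parametrisation). By Carathéodory's theorem for the Jordan domain `D` (proved in the tree:
  `JordanDomain.exists_continuousOn_extension_holds`, `JordanDomain.continuousOn_boundaryExtension_holds`)
  `Φ` is continuous on the closed half-plane and does not take the value `b = Φ(∞)` there
  (`boundaryExtension_ne_pt_one`: interior points go to `D`, real points to `∂D ∖ {b}` by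
  injectivity of the boundary correspondence). A path `γ` in the closed half-plane with
  `Φ ∘ γ → b` must then leave every compact set (`tendsto_norm_atTop_of_tendsto_comp`), i.e.
  `|γ(t)| → ∞`.

Consequences recorded for the dependents of `exists_isSLECurve`: an SLE law or a convergence in
law to SLE_κ in some Dobrushin domain already implies `HasSLETrace κ`
(`IsSLELaw.hasSLETrace`, `ConvergesInLawToSLE.hasSLETrace`).

## Mathlib

We USE `tendsto_norm_cocompact_atTop`, `Filter.hasBasis_cocompact`, `IsCompact.image_of_continuousOn`,
`tendsto_inv_atTop_zero`, `NNReal.tendsto_coe_atTop`, `tendsto_subtype_rng`. From the tree: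
`JordanDomain.IsDiscExtension` and its API (`ChordalBoundary.lean`), `sleTrace_mem_closure`
(`SLEExistence.lean`), `mem_closure_upperHalfPlaneSet_iff` (`CaratheodoryHalfPlane.lean`).

## References

* S. Rohde, O. Schramm, *Basic properties of SLE*, Ann. of Math. 161 (2005), 883–924: Thm. 5.1
  (p. 899) and Thm. 7.1 (p. 909; `κ = 8` by the Update, p. 911).
* G. F. Lawler, O. Schramm, W. Werner, *Conformal invariance of planar loop-erased random walks
  and uniform spanning trees*, Ann. Probab. 32 (2004), Thm. 4.7.
* G. F. Lawler, *Conformally Invariant Processes in the Plane*, AMS (2005), §6.3 (chordal SLE in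
  a simply connected domain as a curve from `a` to `b`).
* Ch. Pommerenke, *Boundary Behaviour of Conformal Maps*, Springer (1992), Thm. 2.6.
-/

noncomputable section

open Set Filter Topology MeasureTheory Complex Metric
open UpperHalfPlane (upperHalfPlaneSet isOpen_upperHalfPlaneSet)
open scoped NNReal unitInterval

namespace Literature.Probability.RandomPlanarGeometry

/-! ### Topological glue: a path whose image under `Φ` tends to an omitted value escapes to infinity -/

/-- **Escape to infinity.** Let `A ⊆ ℂ` be closed, `Φ` continuous on `A` with `Φ z ≠ b` for all
`z ∈ A`, and `γ` a family of points of `A` (along any filter `l`) with `Φ (γ t) → b`. Then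
`‖γ t‖ → ∞`: for a compact `K`, `Φ '' (K ∩ A)` is a compact set missing `b`, so eventually
`Φ (γ t)` avoids it and `γ t ∉ K`. (Used with `A` the closed half-plane, `Φ` the boundary
extension of a chordal uniformizing map, `b = Φ(∞)`, `γ` the SLE trace.) [folklore] -/
theorem tendsto_norm_atTop_of_tendsto_comp {ι : Type*} {l : Filter ι} {A : Set ℂ} {Φ : ℂ → ℂ}
    {γ : ι → ℂ} {b : ℂ} (hA : IsClosed A) (hΦ : ContinuousOn Φ A) (hγA : ∀ t, γ t ∈ A)
    (hne : ∀ z ∈ A, Φ z ≠ b) (hlim : Tendsto (fun t ↦ Φ (γ t)) l (𝓝 b)) :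
    Tendsto (fun t ↦ ‖γ t‖) l atTop := by
  refine tendsto_norm_cocompact_atTop.comp ?_
  rw [hasBasis_cocompact.tendsto_right_iff]
  intro K hK
  have hK' : IsCompact (Φ '' (K ∩ A)) :=
    (hK.inter_right hA).image_of_continuousOn (hΦ.mono inter_subset_right)
  have hb : b ∉ Φ '' (K ∩ A) := by
    rintro ⟨z, hz, rfl⟩
    exact hne z hz.2 rfl
  have hmem : (Φ '' (K ∩ A))ᶜ ∈ 𝓝 b := hK'.isClosed.isOpen_compl.mem_nhds hb
  filter_upwards [hlim hmem] with t ht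
  exact fun htK ↦ ht ⟨γ t, ⟨htK, hγA t⟩, rfl⟩

/-- The inverse `t ↦ t / (1 + t)` of the ray parametrisation tends to `1` in `[0, 1]` as
`t → ∞`. [folklore] -/
theorem tendsto_div_one_add_atTop :
    Tendsto (fun t : ℝ≥0 ↦ (⟨(t : ℝ) / (1 + t), div_nonneg t.2 (by positivity),
      (div_le_one (by positivity)).2 (by linarith [t.2])⟩ : I)) atTop (𝓝 1) := by
  rw [tendsto_subtype_rng]
  have h1 : Tendsto (fun t : ℝ≥0 ↦ (1 : ℝ) + t) atTop atTop :=
    tendsto_atTop_add_const_left atTop 1 (NNReal.tendsto_coe_atTop.2 tendsto_id)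
  have h2 : Tendsto (fun t : ℝ≥0 ↦ (1 : ℝ) - (1 + (t : ℝ))⁻¹) atTop (𝓝 ((1 : I) : ℝ)) := by
    simpa using (tendsto_const_nhds (x := (1 : ℝ))).sub (tendsto_inv_atTop_zero.comp h1)
  refine h2.congr fun t ↦ ?_
  have ht : (1 : ℝ) + t ≠ 0 := by positivity
  field_simp
  ring

namespace IsCompactifiedImage

variable {Φ : ℂ → ℂ} {γ : ℝ≥0 → ℂ} {b : ℂ} {c : Curve ℂ}

/-- **The compactified image tends to its endpoint.** If the continuous curve `c : [0, 1] → ℂ`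
is the time-compactified image of `γ` under `Φ` with endpoint `b` (`c s = Φ (γ (s/(1-s)))` for
`s < 1`, `c 1 = b`), then `Φ (γ t) → b` as `t → ∞`: `Φ (γ t) = c (t/(1+t))` and `c` is
continuous at `1`. Lawler (2005), §6.3 (chordal SLE in `(D; a, b)` is a curve from `a` to `b`).
[folklore] -/
theorem tendsto_atTop (h : IsCompactifiedImage Φ γ b c) :
    Tendsto (fun t ↦ Φ (γ t)) atTop (𝓝 b) := by
  -- the inverse of the ray parametrisation
  set rinv : ℝ≥0 → I := fun t ↦ ⟨(t : ℝ) / (1 + t), div_nonneg t.2 (by positivity),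
    (div_le_one (by positivity)).2 (by linarith [t.2])⟩ with hrinv
  have hrinv1 : ∀ t, ((rinv t : I) : ℝ) < 1 := fun t ↦ by
    change (t : ℝ) / (1 + t) < 1
    rw [div_lt_one (by positivity)]
    linarith
  have hrinvr : ∀ t, rayParam (rinv t) = t := fun t ↦ by
    ext
    simp only [coe_rayParam, hrinv]
    have ht : (1 : ℝ) + t ≠ 0 := by positivity
    field_simp
    ring
  have hc : Tendsto (fun t ↦ c (rinv t)) atTop (𝓝 b) := by
    rw [← h.2]
    exact (c.continuous.tendsto 1).comp tendsto_div_one_add_atTop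
  refine hc.congr fun t ↦ ?_
  rw [h.1 (rinv t) (hrinv1 t), hrinvr]

end IsCompactifiedImage

/-! ### The boundary extension of a chordal uniformizing map omits the target point `b` -/

/-- For a chordal uniformizing map `φ : ℍₒ → D` of a Dobrushin domain `(D; a, b)` (`0 ↦ a`,
`∞ ↦ b`), the boundary extension `Φ` does not take the value `b` on the closed upper half-plane:
points of `ℍₒ` are mapped into `D ∌ b`, and real points to boundary points other than
`b = Φ(∞)` by the injectivity of Carathéodory's boundary correspondence (disc form, proved:
`JordanDomain.exists_continuousOn_extension_holds`; `JordanDomain.IsDiscExtension.boundaryExtension_ofReal_ne`).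
Pommerenke (1992), Thm. 2.6. [cite: PommerenkeBBCM1992, Thm. 2.6] -/
theorem boundaryExtension_ne_pt_one {D : DobrushinDomain}
    {φ : ConformalEquiv upperHalfPlaneSet D.carrier} (hφ : D.IsChordalUniformizing φ) {z : ℂ}
    (hz : z ∈ closure upperHalfPlaneSet) : φ.boundaryExtension z ≠ D.pt 1 := by
  rw [mem_closure_upperHalfPlaneSet_iff] at hz
  rcases hz.lt_or_eq with hlt | heq
  · intro h'
    refine JordanDomain.boundaryExtension_notMem_frontier φ hlt ?_
    rw [h']
    exact D.boundary_mem_frontier (D.mark 1)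
  · obtain ⟨Φd, hd⟩ :=
      JordanDomain.exists_isDiscExtension JordanDomain.exists_continuousOn_extension_holds φ
    have hzre : ((z.re : ℝ) : ℂ) = z := Complex.ext (by simp) (by simp [← heq])
    rw [← hzre, ← hd.apply_one_eq hφ.2]
    exact hd.boundaryExtension_ofReal_ne z.re

/-! ### From an SLE random curve back to the trace theorems -/

section Converse

variable {κ : ℝ≥0} {D : DobrushinDomain} {Γ : (ℝ≥0 → ℝ) → CurveClass ℂ}

/-- An SLE_κ random curve in some Dobrushin domain witnesses that SLE_κ is generated by a curve:
the almost sure clause of `IsSLECurve` contains `Loewner.IsGeneratedByCurve (√κ B) (sleTrace κ ω)`.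
Rohde–Schramm (2005), Thm. 5.1 (the statement witnessed). [folklore] -/
theorem IsSLECurve.hasSLETrace (h : IsSLECurve κ D Γ) : HasSLETrace κ := by
  obtain ⟨-, φ, -, hae⟩ := h
  filter_upwards [hae] with ω hω
  exact ⟨_, hω.1⟩

/-- **Transience from an SLE random curve.** If `Γ` is a chordal SLE_κ random curve in a
Dobrushin domain `(D; a, b)`, then almost surely `|γ(t)| → ∞` for the SLE_κ trace
`γ = sleTrace κ ω`: a.s. `Φ(γ(t)) → b` (`IsCompactifiedImage.tendsto_atTop`, continuity of the
compactified curve at time `1`), `Φ` is continuous on the closed half-plane (Carathéodory,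
`JordanDomain.continuousOn_boundaryExtension_holds`) and omits `b` there
(`boundaryExtension_ne_pt_one`), so `γ` escapes to infinity
(`tendsto_norm_atTop_of_tendsto_comp`). Rohde–Schramm (2005), Thm. 7.1 (the statement
witnessed); Lawler (2005), §6.3. [folklore] -/
theorem IsSLECurve.ae_tendsto_norm_sleTrace_atTop (h : IsSLECurve κ D Γ) :
    ∀ᵐ ω ∂Process.preWienerMeasure, Tendsto (fun t ↦ ‖sleTrace κ ω t‖) atTop atTop := by
  obtain ⟨-, φ, hφ, hae⟩ := h
  have hcont : ContinuousOn φ.boundaryExtension (closure upperHalfPlaneSet) :=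
    JordanDomain.continuousOn_boundaryExtension_holds D.toJordanDomain φ
  filter_upwards [hae] with ω hω
  obtain ⟨-, c, -, hc⟩ := hω
  exact tendsto_norm_atTop_of_tendsto_comp isClosed_closure hcont (sleTrace_mem_closure κ ω)
    (fun z hz ↦ boundaryExtension_ne_pt_one hφ hz) hc.tendsto_atTop

/-- An SLE_κ law in some Dobrushin domain witnesses that SLE_κ is generated by a curve. [folklore] -/
theorem IsSLELaw.hasSLETrace {μ : Measure (CurveClass ℂ)} (h : IsSLELaw κ D μ) : HasSLETrace κ := by
  obtain ⟨Γ, hΓ, -⟩ := h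
  exact hΓ.hasSLETrace

/-- A convergence in law to chordal SLE_κ (as vendored, `ConvergesInLawToSLE`) witnesses that
SLE_κ is generated by a curve. [folklore] -/
theorem ConvergesInLawToSLE.hasSLETrace {Ωδ : ℝ → Type*} [∀ δ, MeasurableSpace (Ωδ δ)]
    {X : ∀ δ, Ωδ δ → CurveClass ℂ} {P : ∀ δ, Measure (Ωδ δ)}
    (h : ConvergesInLawToSLE κ D X P) : HasSLETrace κ := by
  obtain ⟨Γ, hΓ, -, -⟩ := h
  exact hΓ.hasSLETrace

end Converse

/-! ### `exists_isSLECurve` is equivalent to the three trace theorems -/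

/-- `exists_isSLECurve` gives `HasSLETrace κ` for every `κ > 0` (take the unit disc as Dobrushin
domain, `DobrushinDomain.unitDisc`). Rohde–Schramm (2005), Thm. 5.1. [folklore] -/
theorem hasSLETrace_of_exists_isSLECurve (h : exists_isSLECurve) {κ : ℝ≥0} (hκ : 0 < κ) :
    HasSLETrace κ := by
  obtain ⟨Γ, hΓ⟩ := h hκ DobrushinDomain.unitDisc
  exact hΓ.hasSLETrace

/-- `exists_isSLECurve` implies the named fact `hasSLETrace_eight` (Lawler–Schramm–Werner (2004),
Thm. 4.7). [folklore] -/
theorem hasSLETrace_eight_of_exists_isSLECurve (h : exists_isSLECurve) : hasSLETrace_eight :=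
  hasSLETrace_of_exists_isSLECurve h (by norm_num)

/-- `exists_isSLECurve` implies the named fact `hasSLETrace_of_ne_eight` (Rohde–Schramm (2005),
Thm. 5.1): `κ > 0` from `hasSLETrace_of_exists_isSLECurve`, and the case `κ = 0` is the proved
`hasSLETrace_zero`. [folklore] -/
theorem hasSLETrace_of_ne_eight_of_exists_isSLECurve (h : exists_isSLECurve) :
    hasSLETrace_of_ne_eight := by
  intro κ _
  rcases eq_or_ne κ 0 with rfl | hκ
  · exact hasSLETrace_zero
  · exact hasSLETrace_of_exists_isSLECurve h (pos_iff_ne_zero.2 hκ)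

/-- `exists_isSLECurve` implies the named fact `tendsto_norm_sleTrace_atTop` (Rohde–Schramm
(2005), Thm. 7.1), by `IsSLECurve.ae_tendsto_norm_sleTrace_atTop` in the unit disc. [folklore] -/
theorem tendsto_norm_sleTrace_atTop_of_exists_isSLECurve (h : exists_isSLECurve) :
    tendsto_norm_sleTrace_atTop := by
  intro κ hκ
  obtain ⟨Γ, hΓ⟩ := h hκ DobrushinDomain.unitDisc
  exact hΓ.ae_tendsto_norm_sleTrace_atTop

/-- **`exists_isSLECurve` is equivalent to the three SLE trace theorems**: SLE₈ generated by a
curve (`hasSLETrace_eight`, Lawler–Schramm–Werner (2004), Thm. 4.7), SLE_κ generated by a curve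
for `κ ≠ 8` (`hasSLETrace_of_ne_eight`, Rohde–Schramm (2005), Thm. 5.1) and transience
(`tendsto_norm_sleTrace_atTop`, Rohde–Schramm (2005), Thm. 7.1). `←` is
`exists_isSLECurve_of_trace_theorems` (Riemann mapping, Carathéodory, Loewner theory and
measurability of the trace proved in the tree); `→` is this file.
[cite: RohdeSchramm2005, Thm 5.1 and Thm 7.1] -/
theorem exists_isSLECurve_iff :
    exists_isSLECurve ↔
      hasSLETrace_eight ∧ hasSLETrace_of_ne_eight ∧ tendsto_norm_sleTrace_atTop :=
  ⟨fun h ↦ ⟨hasSLETrace_eight_of_exists_isSLECurve h, hasSLETrace_of_ne_eight_of_exists_isSLECurve h,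
    tendsto_norm_sleTrace_atTop_of_exists_isSLECurve h⟩,
    fun h ↦ exists_isSLECurve_of_trace_theorems h.1 h.2.1 h.2.2⟩

/-- The same equivalence with the trace theorems merged: `exists_isSLECurve` holds iff SLE_κ is
generated by a curve for every `κ > 0` and the trace is transient for every `κ > 0`.
[cite: RohdeSchramm2005, Thm 5.1 and Thm 7.1] -/
theorem exists_isSLECurve_iff_forall_hasSLETrace :
    exists_isSLECurve ↔ (∀ κ : ℝ≥0, 0 < κ → HasSLETrace κ) ∧ tendsto_norm_sleTrace_atTop := by
  refine ⟨fun h ↦ ⟨fun κ hκ ↦ hasSLETrace_of_exists_isSLECurve h hκ,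
    tendsto_norm_sleTrace_atTop_of_exists_isSLECurve h⟩, fun ⟨hall, htr⟩ ↦ ?_⟩
  refine exists_isSLECurve_of_trace_theorems (hall 8 (by norm_num)) (fun {κ} _ ↦ ?_) htr
  rcases eq_or_ne κ 0 with rfl | hκ
  · exact hasSLETrace_zero
  · exact hall κ (pos_iff_ne_zero.2 hκ)

end Literature.Probability.RandomPlanarGeometry
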